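import Mathlib
import Summits.PneNP.PneNP.Theorems.SfmBlProp7
import Summits.PneNP.PneNP.Theorems.SfmBlSpotAccounting
import Summits.PneNP.PneNP.Theorems.SfmBlLegModel

/-!
# Proposition 7 in the leg model — line «sfm-bl» (dictionary `sgnMat B T` ↔ `M i k = Σ_{e : i → k} χ(T (out e))`)

FRONTIER F-N1c; nothing here bears on P vs NP.

p3's `SfmBl.sum_trace_pow_le_explicit` (PROOF-SFM-BL Prop. 7, explicit form) is stated in the abstract
output-shared-sign model `M_T = sgnMat B T = Σ_j χ(T_j)·B_j` with leg-multiplicity matrices `B_j ≥ 0`.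
The other bricks of the line (`SfmBlLegModel`, `SfmBlSpotAccounting`, `SfmBlSpotBudget`, `SfmBlAssembly`)
speak the LEG MODEL: legs `e : E` with `src e`, `dst e`, `out e` and `M T i k = Σ_{e : i → k} χ(T (out e))`
as a hypothesis.  This file is the dictionary: with `B j i k := #{e : out e = j, src e = i, dst e = k}` one has
`sgnMat B T = M T` (`sgnMat_legCount_eq`), and the hypotheses of Prop. 7 (`≤ 3` legs per output, one-sided
degrees, support graph, unsigned sparseness on connected pairs) follow from their leg-model counterparts.
Result: `sum_trace_pow_le_legs` — Prop. 7's conclusion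
`Σ_T tr(A_T^{2k}) ≤ 2^m·N·ρ^{2k} + 2^m·4N²L^{2k}/L^{10(t₀+1)+2}` with `A_T = fromBlocks 0 (M T) (M T)ᵀ 0`,
directly in the form consumed by `SfmBl.cutCertified_of_greedy` (`trR T := tr(A_T^{ℓ})`).
-/

namespace Summit.PneNP.PneNP.Theorems.SfmBl

open Matrix Finset BigOperators
open Summit.PneNP.PneNP.Theorems.CandCutNorm

variable {α β : Type} [Fintype α] [Fintype β] [DecidableEq α] [DecidableEq β]
variable {E : Type*} [Fintype E] {m : ℕ}

omit [Fintype α] [Fintype E] in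
/-- One leg contributes to exactly one triple `(out e, src e, dst e)`:
`Σ_j Σ_k [out e = j ∧ src e = i ∧ dst e = k] = [src e = i]`. -/
theorem sum_sum_ite_triple_row (src : E → α) (dst : E → β) (out : E → Fin m) (e : E) (i : α) :
    ∑ j : Fin m, ∑ k : β, (if out e = j ∧ src e = i ∧ dst e = k then (1 : ℝ) else 0)
      = if src e = i then 1 else 0 := by
  rw [Finset.sum_eq_single (out e)]
  · rw [Finset.sum_eq_single (dst e)]
    · simp
    · intro k _ hk; simp [Ne.symm hk]
    · simp
  · intro j _ hj; exact Finset.sum_eq_zero fun k _ => by simp [Ne.symm hj]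
  · simp

omit [Fintype β] [Fintype E] in
/-- Same, summing over outputs and rows: `Σ_j Σ_i [out e = j ∧ src e = i ∧ dst e = k] = [dst e = k]`. -/
theorem sum_sum_ite_triple_col (src : E → α) (dst : E → β) (out : E → Fin m) (e : E) (k : β) :
    ∑ j : Fin m, ∑ i : α, (if out e = j ∧ src e = i ∧ dst e = k then (1 : ℝ) else 0)
      = if dst e = k then 1 else 0 := by
  rw [Finset.sum_eq_single (out e)]
  · rw [Finset.sum_eq_single (src e)]
    · simp
    · intro i _ hi; simp [Ne.symm hi]
    · simp
  · intro j _ hj; exact Finset.sum_eq_zero fun i _ => by simp [Ne.symm hj]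
  · simp

omit [Fintype E] in
/-- Same, summing over rows and columns: `Σ_i Σ_k [out e = j ∧ src e = i ∧ dst e = k] = [out e = j]`. -/
theorem sum_sum_ite_triple_out (src : E → α) (dst : E → β) (out : E → Fin m) (e : E) (j : Fin m) :
    ∑ i : α, ∑ k : β, (if out e = j ∧ src e = i ∧ dst e = k then (1 : ℝ) else 0)
      = if out e = j then 1 else 0 := by
  rw [Finset.sum_eq_single (src e)]
  · rw [Finset.sum_eq_single (dst e)]
    · simp
    · intro k _ hk; simp [Ne.symm hk]
    · simp
  · intro i _ hi; exact Finset.sum_eq_zero fun k _ => by simp [Ne.symm hi]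
  · simp

omit [Fintype α] [Fintype β] in
/-- The leg count of a triple as an indicator sum. -/
theorem legCount_eq_sum_ite (src : E → α) (dst : E → β) (out : E → Fin m) (j : Fin m) (i : α) (k : β) :
    ((Finset.univ.filter fun e => out e = j ∧ src e = i ∧ dst e = k).card : ℝ)
      = ∑ e, (if out e = j ∧ src e = i ∧ dst e = k then (1 : ℝ) else 0) := by
  simp [Finset.sum_boole]

omit [Fintype α] [Fintype β] in
/-- DICTIONARY: with `B j i k = #{e : out e = j, src e = i, dst e = k}`, the abstract signed matrix
`sgnMat B T` is the leg-model matrix `Σ_{e : i → k} χ(T (out e))`. -/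
theorem sgnMat_legCount_eq (src : E → α) (dst : E → β) (out : E → Fin m) (B : Fin m → Matrix α β ℝ)
    (hB : ∀ j i k, B j i k = ((Finset.univ.filter fun e => out e = j ∧ src e = i ∧ dst e = k).card : ℝ))
    (T : Fin m → Bool) (i : α) (k : β) :
    sgnMat B T i k = ∑ e ∈ Finset.univ.filter (fun e => src e = i ∧ dst e = k),
      ((boolSign (T (out e)) : ℤ) : ℝ) := by
  classical
  rw [sgnMat_apply]
  simp_rw [hB, legCount_eq_sum_ite, Finset.mul_sum]
  rw [Finset.sum_comm, Finset.sum_filter]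
  refine Finset.sum_congr rfl fun e _ => ?_
  by_cases h : src e = i ∧ dst e = k
  · rw [if_pos h, Finset.sum_eq_single (out e)]
    · simp [h]
    · intro j _ hj; simp [Ne.symm hj]
    · simp
  · rw [if_neg h]
    exact Finset.sum_eq_zero fun j _ => by
      have : ¬ (out e = j ∧ src e = i ∧ dst e = k) := fun h' => h h'.2
      simp [this]

omit [Fintype α] [Fintype β] in
/-- The unsigned multiplicity matrix `Σ_j B j` of the leg counts: `(Σ_j B j) i k = #{e : src e = i, dst e = k}`,
as an indicator sum. -/
theorem sum_legCount_apply (src : E → α) (dst : E → β) (out : E → Fin m) (B : Fin m → Matrix α β ℝ)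
    (hB : ∀ j i k, B j i k = ((Finset.univ.filter fun e => out e = j ∧ src e = i ∧ dst e = k).card : ℝ))
    (i : α) (k : β) :
    (∑ j, B j) i k = ∑ _e ∈ Finset.univ.filter (fun e => src e = i ∧ dst e = k), (1 : ℝ) := by
  classical
  rw [Matrix.sum_apply]
  simp_rw [hB, legCount_eq_sum_ite]
  rw [Finset.sum_comm, Finset.sum_filter]
  refine Finset.sum_congr rfl fun e _ => ?_
  by_cases h : src e = i ∧ dst e = k
  · rw [if_pos h, Finset.sum_eq_single (out e)]
    · simp [h]
    · intro j _ hj; simp [Ne.symm hj]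
    · simp
  · rw [if_neg h]
    exact Finset.sum_eq_zero fun j _ => by
      have : ¬ (out e = j ∧ src e = i ∧ dst e = k) := fun h' => h h'.2
      simp [this]

/-- PROPOSITION 7 IN THE LEG MODEL (explicit form).  Legs `e : E` of the sparse remainder with `src, dst, out`;
`≤ 3` legs per output (`hout`); leg-degrees `≤ L₀ ≤ L` (`hdeg₁, hdeg₂`); a graph `G` on `α ⊕ β` containing every
leg, with degrees `≤ Ldeg ≤ L`; thresholds `0 ≤ γ' ≤ γ_sp`, `γ'² ≥ 144·L·ln L`, `0 < γ_sp ≤ L`, `2 ≤ L`;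
UNSIGNED SPARSENESS: every `G`-connected pair of total size `≤ t₀` has `e(W₁,W₂) ≤ γ_sp√(|W₁||W₂|)`;
signed matrices `M T i k = Σ_{e : i → k} χ(T (out e))` (hypothesis `hM`).  Then
`Σ_T tr((fromBlocks 0 (M T) (M T)ᵀ 0)^{2k}) ≤ 2^m·N·ρ^{2k} + 2^m·4N²·L^{2k}/L^{10(t₀+1)+2}`,
`N = |α|+|β|`, `ρ = 100·γ_sp·(log₂(L/γ_sp)+1)` — p3's `sum_trace_pow_le_explicit` through the dictionary. -/
theorem sum_trace_pow_le_legs (src : E → α) (dst : E → β) (out : E → Fin m)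
    (hout : ∀ j : Fin m, (Finset.univ.filter fun e => out e = j).card ≤ 3)
    {L₀ : ℕ} (hdeg₁ : ∀ i, (Finset.univ.filter fun e => src e = i).card ≤ L₀)
    (hdeg₂ : ∀ k, (Finset.univ.filter fun e => dst e = k).card ≤ L₀)
    {L : ℝ} (hL : 2 ≤ L) (hL₀ : (L₀ : ℝ) ≤ L)
    (G : SimpleGraph (α ⊕ β)) [DecidableRel G.Adj] (hG : ∀ e, G.Adj (Sum.inl (src e)) (Sum.inr (dst e)))
    {Ldeg : ℕ} (hGdeg : ∀ x, G.degree x ≤ Ldeg) (hLdeg : (Ldeg : ℝ) ≤ L)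
    {γ' γsp : ℝ} (hγ' : 0 ≤ γ') (hγ'L : 144 * L * Real.log L ≤ γ' ^ 2) (hγ : γ' ≤ γsp)
    (hγsp : 0 < γsp) (hγspL : γsp ≤ L) (t₀ : ℕ)
    (hsparse : ∀ (W₁ : Finset α) (W₂ : Finset β),
      (G.induce {x | Sum.elim (fun i => i ∈ W₁) (fun j => j ∈ W₂) x}).Connected →
      W₁.card + W₂.card ≤ t₀ →
      ((Finset.univ.filter fun e => src e ∈ W₁ ∧ dst e ∈ W₂).card : ℝ)
        ≤ γsp * Real.sqrt ((W₁.card : ℝ) * (W₂.card : ℝ)))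
    (M : (Fin m → Bool) → Matrix α β ℝ)
    (hM : ∀ T i k, M T i k = ∑ e ∈ Finset.univ.filter (fun e => src e = i ∧ dst e = k),
      ((boolSign (T (out e)) : ℤ) : ℝ))
    (k : ℕ) :
    ∑ T : Fin m → Bool,
        ((Matrix.fromBlocks (0 : Matrix α α ℝ) (M T) (M T)ᵀ (0 : Matrix β β ℝ)) ^ (2 * k)).trace
      ≤ 2 ^ m * ((Fintype.card α + Fintype.card β)
            * (100 * (γsp * (Real.logb 2 (L / γsp) + 1))) ^ (2 * k))
        + 2 ^ m * (4 * (Fintype.card α + Fintype.card β) ^ 2 * L ^ (2 * k)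
            * (L ^ (10 * (t₀ + 1) + 2))⁻¹) := by
  classical
  -- the leg-count model
  let B : Fin m → Matrix α β ℝ := fun j i k' =>
    ((Finset.univ.filter fun e => out e = j ∧ src e = i ∧ dst e = k').card : ℝ)
  have hBdef : ∀ j i k', B j i k'
      = ((Finset.univ.filter fun e => out e = j ∧ src e = i ∧ dst e = k').card : ℝ) := fun _ _ _ => rfl
  -- dictionary `M T = sgnMat B T`
  have hMT : ∀ T, M T = sgnMat B T := by
    intro T; ext i k'
    rw [hM T i k', sgnMat_legCount_eq src dst out B hBdef T i k']
  simp only [hMT]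
  -- hypotheses of the abstract Prop. 7
  have hB0 : ∀ j i k', 0 ≤ B j i k' := fun _ _ _ => Nat.cast_nonneg _
  have hlegs : ∀ j, ∑ i, ∑ k', B j i k' ≤ 3 := by
    intro j
    have h1 : ∑ i, ∑ k', B j i k' = ((Finset.univ.filter fun e => out e = j).card : ℝ) := by
      calc ∑ i, ∑ k', B j i k'
          = ∑ i : α, ∑ k' : β, ∑ e : E, (if out e = j ∧ src e = i ∧ dst e = k' then (1 : ℝ) else 0) := by
            simp_rw [hBdef, legCount_eq_sum_ite]
        _ = ∑ i : α, ∑ e : E, ∑ k' : β, (if out e = j ∧ src e = i ∧ dst e = k' then (1 : ℝ) else 0) :=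
            Finset.sum_congr rfl fun i _ => Finset.sum_comm
        _ = ∑ e : E, ∑ i : α, ∑ k' : β, (if out e = j ∧ src e = i ∧ dst e = k' then (1 : ℝ) else 0) :=
            Finset.sum_comm
        _ = ∑ e : E, (if out e = j then (1 : ℝ) else 0) :=
            Finset.sum_congr rfl fun e _ => sum_sum_ite_triple_out src dst out e j
        _ = ((Finset.univ.filter fun e => out e = j).card : ℝ) := by simp [Finset.sum_boole]
    rw [h1]; exact_mod_cast hout j
  have hrow : ∀ i, ∑ j, ∑ k', B j i k' ≤ L := by
    intro i
    have h1 : ∑ j, ∑ k', B j i k' = ((Finset.univ.filter fun e => src e = i).card : ℝ) := by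
      calc ∑ j, ∑ k', B j i k'
          = ∑ j : Fin m, ∑ k' : β, ∑ e : E, (if out e = j ∧ src e = i ∧ dst e = k' then (1 : ℝ) else 0) := by
            simp_rw [hBdef, legCount_eq_sum_ite]
        _ = ∑ j : Fin m, ∑ e : E, ∑ k' : β, (if out e = j ∧ src e = i ∧ dst e = k' then (1 : ℝ) else 0) :=
            Finset.sum_congr rfl fun j _ => Finset.sum_comm
        _ = ∑ e : E, ∑ j : Fin m, ∑ k' : β, (if out e = j ∧ src e = i ∧ dst e = k' then (1 : ℝ) else 0) :=
            Finset.sum_comm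
        _ = ∑ e : E, (if src e = i then (1 : ℝ) else 0) :=
            Finset.sum_congr rfl fun e _ => sum_sum_ite_triple_row src dst out e i
        _ = ((Finset.univ.filter fun e => src e = i).card : ℝ) := by simp [Finset.sum_boole]
    rw [h1]; exact le_trans (by exact_mod_cast hdeg₁ i) hL₀
  have hcol : ∀ k', ∑ j, ∑ i, B j i k' ≤ L := by
    intro k'
    have h1 : ∑ j, ∑ i, B j i k' = ((Finset.univ.filter fun e => dst e = k').card : ℝ) := by
      calc ∑ j, ∑ i, B j i k'
          = ∑ j : Fin m, ∑ i : α, ∑ e : E, (if out e = j ∧ src e = i ∧ dst e = k' then (1 : ℝ) else 0) := by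
            simp_rw [hBdef, legCount_eq_sum_ite]
        _ = ∑ j : Fin m, ∑ e : E, ∑ i : α, (if out e = j ∧ src e = i ∧ dst e = k' then (1 : ℝ) else 0) :=
            Finset.sum_congr rfl fun j _ => Finset.sum_comm
        _ = ∑ e : E, ∑ j : Fin m, ∑ i : α, (if out e = j ∧ src e = i ∧ dst e = k' then (1 : ℝ) else 0) :=
            Finset.sum_comm
        _ = ∑ e : E, (if dst e = k' then (1 : ℝ) else 0) :=
            Finset.sum_congr rfl fun e _ => sum_sum_ite_triple_col src dst out e k'
        _ = ((Finset.univ.filter fun e => dst e = k').card : ℝ) := by simp [Finset.sum_boole]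
    rw [h1]; exact le_trans (by exact_mod_cast hdeg₂ k') hL₀
  have hG' : ∀ j i k', B j i k' ≠ 0 → G.Adj (Sum.inl i) (Sum.inr k') := by
    intro j i k' hne
    have hne' : (Finset.univ.filter fun e => out e = j ∧ src e = i ∧ dst e = k').card ≠ 0 := by
      intro h0; apply hne; simp only [hBdef, h0, Nat.cast_zero]
    obtain ⟨e, he⟩ := Finset.card_ne_zero.1 hne'
    simp only [Finset.mem_filter, Finset.mem_univ, true_and] at he
    rw [← he.2.1, ← he.2.2]; exact hG e
  -- unsigned sparseness in the `u, v` form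
  have hsparse' : ∀ (u : α → ℝ) (v : β → ℝ), (∀ i, u i = 0 ∨ u i = 1) → (∀ k', v k' = 0 ∨ v k' = 1) →
      (G.induce {x | Sum.elim u v x = 1}).Connected → (∑ i, u i) + (∑ k', v k') ≤ t₀ →
      u ⬝ᵥ ((∑ j, B j) *ᵥ v) ≤ γsp * Real.sqrt ((∑ i, u i) * (∑ k', v k')) := by
    intro u v hu hv hconn hsize
    set W₁ : Finset α := Finset.univ.filter fun i => u i = 1 with hW₁
    set W₂ : Finset β := Finset.univ.filter fun k' => v k' = 1 with hW₂
    have hu_ind : ∀ i, u i = if i ∈ W₁ then 1 else 0 := by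
      intro i; rcases hu i with h | h <;> simp [hW₁, h]
    have hv_ind : ∀ k', v k' = if k' ∈ W₂ then 1 else 0 := by
      intro k'; rcases hv k' with h | h <;> simp [hW₂, h]
    have hsumu : ∑ i, u i = (W₁.card : ℝ) := by
      rw [Finset.sum_congr rfl (fun i _ => hu_ind i), Finset.sum_boole]; simp
    have hsumv : ∑ k', v k' = (W₂.card : ℝ) := by
      rw [Finset.sum_congr rfl (fun k' _ => hv_ind k'), Finset.sum_boole]; simp
    have hXeq : {x : α ⊕ β | Sum.elim u v x = 1} = {x | Sum.elim (fun i => i ∈ W₁) (fun j => j ∈ W₂) x} := by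
      ext x; cases x with
      | inl i => simp [hW₁]
      | inr j => simp [hW₂]
    rw [hXeq] at hconn
    have hsize' : W₁.card + W₂.card ≤ t₀ := by
      have : ((W₁.card : ℝ) + W₂.card) ≤ t₀ := by rw [← hsumu, ← hsumv]; exact hsize
      exact_mod_cast this
    have hsp := hsparse W₁ W₂ hconn hsize'
    -- the bilinear form of the multiplicity matrix is the edge count
    have hform : u ⬝ᵥ ((∑ j, B j) *ᵥ v)
        = ((Finset.univ.filter fun e => src e ∈ W₁ ∧ dst e ∈ W₂).card : ℝ) := by
      rw [bilin_eq_sum_legs src dst (fun _ => (1 : ℝ)) (∑ j, B j)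
        (fun i k' => sum_legCount_apply src dst out B hBdef i k') u v]
      rw [Finset.sum_congr rfl (fun e _ => by rw [hu_ind (src e), hv_ind (dst e)])]
      have : ∀ e : E, (1 : ℝ) * (if src e ∈ W₁ then (1 : ℝ) else 0) * (if dst e ∈ W₂ then (1 : ℝ) else 0)
          = if src e ∈ W₁ ∧ dst e ∈ W₂ then 1 else 0 := by
        intro e; by_cases h1 : src e ∈ W₁ <;> by_cases h2 : dst e ∈ W₂ <;> simp [h1, h2]
      simp_rw [this]
      simp [Finset.sum_boole]
    rw [hform, hsumu, hsumv]
    exact hsp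
  exact sum_trace_pow_le_explicit B hB0 hlegs hL hrow hcol G hG' hGdeg hLdeg hγ' hγ'L hγ hγsp hγspL t₀
    hsparse' k

end Summit.PneNP.PneNP.Theorems.SfmBl
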